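import Summits.HodgeConjecture.HodgeConjecture.Theorems.PadicSemiregularLiftHodgeAbelianVarietiesEStepDefs
import Literature.AlgebraicGeometry.HodgeTheory.WeilClassesSixfolds
import Literature.AlgebraicGeometry.HodgeTheory.HodgeConjecture
import Literature.AlgebraicGeometry.Motives.AbelianVarietyProjectiveChart

/-!
# Crux `HodgeAbelianVarieties` (stmt-HodgeConjecture-1333), line `e-step-secant-induction` — stub `stub_splitSixfolds`: audit and the polarized form from Markman's Theorem 1.5.1

The registered stub `stub_splitSixfolds : ∀ d : ℕ, 0 < d → WeilAlgebraicSplit 3 d` (vocabulary of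
`Theorems/PadicSemiregularLiftHodgeAbelianVarietiesEStepDefs`: on every SPLIT Weil triple `(A, φ, h)` of
dimension `6`, `φ ≫ φ = -d`, the rational `(3,3)`-classes of the Weil plane `weilClassesOf A φ 3 d` are
algebraic) is meant to be E. Markman, arXiv:2502.03415, **Theorem 1.5.1**: "Let `d` be a positive integer.
Set `K := ℚ(√-d)`. The Hodge-Weil classes of polarized abelian sixfolds of Weil type with complex
multiplication by `K` and with discriminant `-1` are algebraic." The tree already carries that theorem as
the accepted NAMED FACT `Markman2025_weilClasses_algebraic_hyperbolicSixfold` (file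
`Literature/AlgebraicGeometry/HodgeTheory/WeilClassesSixfolds`; second reading `…SixfoldsSplit`), whose
POLARIZATION is rendered by the tree's ampleness proxy: the `K`-symmetrised hyperplane class
`d · e^*a + φ^*(e^*a)` of a projective embedding `e : A.X ↪ ℙᴺ` and a non-zero rational `a ∈ H²(ℙᴺ(ℂ); ℂ)`.

## Audit of the typed stub (this file's finding)

`IsSplitWeilTriple n d A φ h` asks `IsPolarizationClass (2n) A.X h` (rational, supported on a divisor,
hard Lefschetz — NO positivity), `φ^* h = d h` and `IsHyperbolicWeilType A φ n h` (a `φ^*`-stable rational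
Lagrangian `2n`-frame of `H¹` for `h^{2n-1} ⌣ x ⌣ y`). All three are invariant under `h ↦ c • h`,
`c ∈ ℚ^×` (`isSplitWeilTriple_smul`, PROVED; in particular under `h ↦ -h`), so the predicate sees a
`K`-compatible NON-DEGENERATE divisor class up to `ℚ^×`, i.e. (van Geemen LNM 1594, 5.2) a non-degenerate
`K`-Hermitian form `H_h` on `H₁(A, ℚ)` of Witt index `n`, attached to a possibly INDEFINITE class. Print
(and the named fact) cover `(A, φ)` as soon as SOME ample `K`-compatible class on the same `(A, φ)` has
discriminant `-1`; this is automatic when `dim NS^K(A)_ℚ = 1` (general members of each Weil family: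
`h = ±` ample), and in the special configurations checked by hand (products of general members, isotypic
powers, simple `A` with `End⁰(A)` a CM field of degree `4` or `6`) indefinite members add no discriminant
that ample members miss; but it is NOT a printed statement in general (special members with
`dim NS^K ≥ 2`, e.g. CM members with `[End⁰(A):ℚ] = 12` and non-Galois `L⁺`, lead to norm-coset questions
`N(M_ε) ∈ N(L⁺_{≫0})·Nm(K^×)` for indefinite sign patterns `ε` that no source settles). Hence the
registered stub is HC-implied (`weilAlgebraicFor_of_hodgeConjectureFor`) but a priori WIDER than
Theorem 1.5.1: MIS-STATED relative to print by exactly one missing clause, the ampleness proxy.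
Two harmless points of the same audit: (b) `d` a square or non-squarefree is print's own convention
("`d` a positive integer", `K = ℚ(√-d)`, an order of `K` acting); (c) the hypothesis is at present
UNEXHIBITED in the tree (its only constructed Weil-type abelian varieties are the surfaces `E_τ × E_τ` of
`WeilSurfaceSquareModel` and their products; no `IsSplitWeilTriple 3 d _ _ _` has been proved) — not
vacuous, since `AbelianVariety ℂ` is a genuine bundled structure.

## What is proved here (no `sorry`, no new named fact)

* `IsHyperplaneClass X h`: `h = e^*a` for a projective embedding `e` and a non-zero rational
  `a ∈ H²(ℙᴺ(ℂ); ℂ)` — the tree's ampleness proxy (`h = ±q · c₁(𝒪(1))`, `q ∈ ℚ_{>0}`), as in the named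
  facts `Markman2025_weilClasses_algebraic_hyperbolicSixfold`,
  `Markman2025_exists_weilTypeSurface_prod_isHyperbolicWeilType` and the route decl
  `HeckePrymWeil.HyperbolicEightfoldsSqrtMinus7`.
* `WeilAlgebraicSplitPolarized n d` := the registered `WeilAlgebraicSplit n d` with the ONE extra
  hypothesis `IsHyperplaneClass A.X h` (the corrected stub shape, minimal change), and
  `WeilAlgebraicSplitHyperplane n d` := the same in the tree's symmetrised convention
  (`d·e^*a + φ^*(e^*a)`, no `IsPolarizationClass`, no separate `φ^* h = d h`).
* `weilAlgebraicSplitPolarized_of_split` (registered ⟹ corrected, trivially);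
  `weilAlgebraicSplitPolarized_of_hyperplane` (symmetrised ⟹ corrected: for `h = e^*a` with
  `φ^* h = d h` the symmetrised class is `(d + d) • h`, and hyperbolicity is scale invariant);
  `weilAlgebraicSplitHyperplane_three_iff_markman` (**at `n = 3` the symmetrised form IS the named
  fact**, the only input being that complex abelian varieties are smooth projective —
  `AbelianVariety.isSmoothProjective_holds`, PROVED in the tree);
  `stub_splitSixfolds_of_markman` (**the corrected stub from the named fact**; registered sub-goal).
* `weilAlgebraicFor_of_hodgeConjectureFor`: every statement here is an instance of the summit.

Not provable and not claimed: `Markman… → WeilAlgebraicSplit 3 d` as registered (an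
`IsPolarizationClass` carries no projective embedding, and the indefinite classes above are outside
print).
-/

set_option linter.dupNamespace false

noncomputable section

open CategoryTheory
open Literature.AlgebraicGeometry Literature.AlgebraicGeometry.Motives
  Literature.AlgebraicGeometry.HodgeTheory Literature.Geometry.Kaehler

namespace Summit.HodgeConjecture.HodgeConjecture.Cruxes.HodgeAbelianVarieties.EStepSecantInduction.Stubs

/-! ### The ampleness proxy and the corrected predicates -/

/-- **`h` is a hyperplane class up to `ℚ^×`**: `h = e^*a` for a projective embedding `e : X ↪ ℙᴺ` and a
non-zero rational class `a ∈ H²(ℙᴺ(ℂ); ℂ)` (so `h = ±q · c₁(𝒪_X(1))`, `q ∈ ℚ_{>0}`: `h` or `-h` is very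
ample). This is the tree's rendering of "polarization" in
`Markman2025_weilClasses_algebraic_hyperbolicSixfold` (there in the `K`-symmetrised form
`d·e^*a + φ^*(e^*a)`). [cite: Markman2025SecantWeil, §1.1 and Thm. 1.5.1] -/
def IsHyperplaneClass (X : SchemeOver ℂ) (h : complexBetti X 2) : Prop :=
  ∃ (e : ProjectiveEmbedding X) (a : complexBetti (projectiveSpace e.n ℂ) 2),
    IsRationalClass a ∧ a ≠ 0 ∧ complexBetti.map e.ι 2 a = h

/-- **Weil classes are algebraic on every POLARIZED split Weil triple of dimension `2n`** for
`K = ℚ(√-d)`: the registered `WeilAlgebraicSplit n d` with the single extra hypothesis that the class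
`h` of the split triple is a hyperplane class up to `ℚ^×` (`IsHyperplaneClass`) — the corrected shape
of `stub_splitSixfolds` / `stub_eTower`. [cite: Markman2025SecantWeil, Thm. 1.5.1]
[cite: Markman2025SurveySecant, §11.5] -/
def WeilAlgebraicSplitPolarized (n d : ℕ) : Prop :=
  ∀ (A : AbelianVariety ℂ) (φ : A ⟶ A) (h : complexBetti A.X 2),
    IsSplitWeilTriple n d A φ h → IsHyperplaneClass A.X h → WeilAlgebraicFor n d A φ

/-- The same sector in the tree's SYMMETRISED convention (literal shape of the named fact, for all
`n`): for a projective embedding `e` and a non-zero rational `a ∈ H²(ℙᴺ(ℂ); ℂ)` such that `(A, φ)` is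
of hyperbolic Weil type for `d·e^*a + φ^*(e^*a)`, the Weil classes of `(A, φ)` in half-dimension `n`
are algebraic. [cite: Markman2025SecantWeil, Thm. 1.5.1] [cite: vanGeemen1994HodgeAV, Lemma 5.2 and 5.4] -/
def WeilAlgebraicSplitHyperplane (n d : ℕ) : Prop :=
  ∀ (A : AbelianVariety ℂ) (φ : A ⟶ A) (e : ProjectiveEmbedding A.X)
    (a : complexBetti (projectiveSpace e.n ℂ) 2), A.dim = 2 * n → φ ≫ φ = -(d • 𝟙 A) →
      IsRationalClass a → a ≠ 0 →
        IsHyperbolicWeilType A φ n ((d : ℂ) • complexBetti.map e.ι 2 a +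
          complexBetti.map φ.hom.hom.hom 2 (complexBetti.map e.ι 2 a)) →
          WeilAlgebraicFor n d A φ

/-! ### The registered predicate carries no positivity: invariance under `h ↦ c • h`, `c ∈ ℚ^×` -/

/-- Hard Lefschetz is insensitive to rescaling the class by a non-zero scalar: `Lʲ_{c κ} = cʲ Lʲ_κ`.
[folklore] -/
theorem hasHardLefschetzProperty_smul {X : SchemeOver ℂ} {h : complexBetti X 2} {m : ℕ}
    (hL : HasHardLefschetzProperty h m) {c : ℂ} (hc : c ≠ 0) :
    HasHardLefschetzProperty (c • h) m := by
  intro j k hjk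
  have e : Function.Bijective (fun x : complexBetti X (k + 2 * j) => c ^ j • x) :=
    (LinearEquiv.smulOfNeZero ℂ (complexBetti X (k + 2 * j)) (c ^ j) (pow_ne_zero j hc)).bijective
  convert e.comp (hL j k hjk) using 1
  funext x
  simp only [Function.comp_apply]
  exact lefschetzPow_smul c h j k x

/-- `IsPolarizationClass` is invariant under `h ↦ c • h`, `c ∈ ℚ^×` (rationality, support on a divisor
and hard Lefschetz are): the tree's polarization classes form a cone stable under `-1`, i.e. carry
no positivity. [folklore] -/
theorem isPolarizationClass_smul {X : SchemeOver ℂ} {h : complexBetti X 2} {m : ℕ}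
    (hp : IsPolarizationClass m X h) {c : ℚ} (hc : c ≠ 0) : IsPolarizationClass m X ((c : ℂ) • h) :=
  ⟨hp.isRationalClass.smul c, Submodule.smul_mem _ _ hp.mem_algebraicClasses,
    hasHardLefschetzProperty_smul hp.hasHardLefschetz (by exact_mod_cast hc)⟩

/-- **`IsSplitWeilTriple n d A φ h → IsSplitWeilTriple n d A φ (c • h)` for every `c ∈ ℚ^×`**, in
particular for `c = -1`: the registered notion of "split polarized Weil triple" does not distinguish
a class from its negative (or from any non-zero rational multiple), so it quantifies over
`K`-compatible non-degenerate divisor classes of EITHER sign / any signature, not over polarizations.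
This is the formal content of the audit "no positivity carrier". [folklore] -/
theorem isSplitWeilTriple_smul {n d : ℕ} {A : AbelianVariety ℂ} {φ : A ⟶ A} {h : complexBetti A.X 2}
    (ht : IsSplitWeilTriple n d A φ h) {c : ℚ} (hc : c ≠ 0) :
    IsSplitWeilTriple n d A φ ((c : ℂ) • h) := by
  obtain ⟨hA, hφ, hp, hφh, hhyp⟩ := ht
  have hc' : (c : ℂ) ≠ 0 := by exact_mod_cast hc
  refine ⟨hA, hφ, isPolarizationClass_smul hp hc, ?_, (isHyperbolicWeilType_smul_iff hc').2 hhyp⟩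
  rw [map_smul, hφh, smul_comm]

/-- The invariance as an `iff` (apply it to `c` and `c⁻¹`). [folklore] -/
theorem isSplitWeilTriple_smul_iff {n d : ℕ} {A : AbelianVariety ℂ} {φ : A ⟶ A}
    {h : complexBetti A.X 2} {c : ℚ} (hc : c ≠ 0) :
    IsSplitWeilTriple n d A φ ((c : ℂ) • h) ↔ IsSplitWeilTriple n d A φ h := by
  refine ⟨fun ht => ?_, fun ht => isSplitWeilTriple_smul ht hc⟩
  have h1 := isSplitWeilTriple_smul ht (inv_ne_zero hc)
  rwa [smul_smul, ← Rat.cast_mul, inv_mul_cancel₀ hc, Rat.cast_one, one_smul] at h1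

/-! ### Comparison of the three shapes -/

/-- The registered statement implies the corrected one (drop the extra hypothesis). [folklore] -/
theorem weilAlgebraicSplitPolarized_of_split {n d : ℕ} (H : WeilAlgebraicSplit n d) :
    WeilAlgebraicSplitPolarized n d :=
  fun A φ h ht _ => H A φ h ht

/-- For a `φ`-compatible class (`φ^* h = d h`) the `K`-symmetrised class is a multiple:
`d • h + φ^* h = (d + d) • h`. [cite: Markman2025SecantWeil, §1.1] -/
theorem symmetrised_eq_smul {d : ℕ} {A : AbelianVariety ℂ} {φ : A ⟶ A} {h : complexBetti A.X 2}
    (hφh : complexBetti.map φ.hom.hom.hom 2 h = (d : ℂ) • h) :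
    (d : ℂ) • h + complexBetti.map φ.hom.hom.hom 2 h = ((d : ℂ) + d) • h := by
  rw [hφh, ← add_smul]

/-- **Symmetrised ⟹ corrected**: on a split triple whose class is `h = e^*a`, the symmetrised
hyperplane class `d·e^*a + φ^*(e^*a)` equals `(d + d) • h` (`φ^* h = d h`), and hyperbolicity is
invariant under non-zero rescaling (`isHyperbolicWeilType_smul_iff`), so the symmetrised statement
applies. [cite: Markman2025SecantWeil, §1.1 and Thm. 1.5.1] -/
theorem weilAlgebraicSplitPolarized_of_hyperplane {n d : ℕ} (hd : 0 < d)
    (H : WeilAlgebraicSplitHyperplane n d) : WeilAlgebraicSplitPolarized n d := by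
  rintro A φ h ⟨hA, hφ, _, hφh, hhyp⟩ ⟨e, a, ha, ha0, hea⟩
  have hc : ((d : ℂ) + d) ≠ 0 := by
    have : ((d + d : ℕ) : ℂ) ≠ 0 := Nat.cast_ne_zero.2 (by omega)
    push_cast at this
    exact this
  refine H A φ e a hA hφ ha ha0 ?_
  rw [hea, symmetrised_eq_smul hφh]
  exact (isHyperbolicWeilType_smul_iff hc).2 hhyp

/-- **At `n = 3` the symmetrised statement, for all `d ≥ 1`, IS Markman's Theorem 1.5.1 as recorded in
the tree** (`Markman2025_weilClasses_algebraic_hyperbolicSixfold`): the only difference is the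
hypothesis `IsSmoothProjective 6 A.X` of the named fact, discharged by the tree's theorem that complex
abelian varieties are smooth projective (`AbelianVariety.isSmoothProjective_holds`).
[cite: Markman2025SecantWeil, Thm. 1.5.1] [cite: MumfordAV1970, §4 (ii) and §6 Application 1 (p. 62)] -/
theorem weilAlgebraicSplitHyperplane_three_iff_markman :
    (∀ d : ℕ, 0 < d → WeilAlgebraicSplitHyperplane 3 d) ↔
      Markman2025_weilClasses_algebraic_hyperbolicSixfold := by
  constructor
  · intro H d hd A φ hA _hX hφ e a ha ha0 hhyp c hc h33 hw
    exact H d hd A φ e a hA hφ ha ha0 hhyp c hw hc h33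
  · intro hM d hd A φ e a hA hφ ha ha0 hhyp c hw hc h33
    have hX : IsSmoothProjective (2 * 3) A.X := by
      rw [← hA]
      exact AbelianVariety.isSmoothProjective_holds
    exact hM d hd A φ hA hX hφ e a ha ha0 hhyp c hc h33 hw

/-- **The corrected stub from the named fact** (registered sub-goal `stub_splitSixfolds_of_markman` of
stmt-HodgeConjecture-1333): Markman's Theorem 1.5.1 gives the Weil classes of every split Weil SIXFOLD
whose class `h` is a hyperplane class up to `ℚ^×` — i.e. `stub_splitSixfolds` with the ampleness proxy
added to `IsSplitWeilTriple`. [cite: Markman2025SecantWeil, Thm. 1.5.1] -/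
theorem stub_splitSixfolds_of_markman :
    Markman2025_weilClasses_algebraic_hyperbolicSixfold → ∀ d : ℕ, 0 < d → WeilAlgebraicSplitPolarized 3 d :=
  fun hM d hd =>
    weilAlgebraicSplitPolarized_of_hyperplane hd (weilAlgebraicSplitHyperplane_three_iff_markman.2 hM d hd)

/-! ### Upper bound: everything here is an instance of the summit statement -/

/-- `WeilAlgebraicFor n d A φ` is an instance of the Hodge conjecture for `A.X` in dimension `2n`
(its degree-`2n`, codimension-`n` clause restricted to the Weil plane). [cite: Deligne2000, §1] -/
theorem weilAlgebraicFor_of_hodgeConjectureFor {n d : ℕ} {A : AbelianVariety ℂ} {φ : A ⟶ A}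
    (h : HodgeConjectureFor (2 * n) A.X) : WeilAlgebraicFor n d A φ :=
  fun c _ hc hH => h.2 n c hc hH

/-- Hence the corrected statements are HC-implied for every `n, d` (as is the registered one).
[cite: Deligne2000, §1] -/
theorem weilAlgebraicSplitPolarized_of_hodgeConjectureFor {n d : ℕ}
    (h : ∀ A : AbelianVariety ℂ, A.dim = 2 * n → HodgeConjectureFor (2 * n) A.X) :
    WeilAlgebraicSplitPolarized n d :=
  fun A _ _ ht _ => weilAlgebraicFor_of_hodgeConjectureFor (h A ht.1)

end Summit.HodgeConjecture.HodgeConjecture.Cruxes.HodgeAbelianVarieties.EStepSecantInduction.Stubs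

end
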